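/-
Copyright (c) 2026. All rights reserved.
Released under Apache 2.0 license as described in the file LICENSE.
Authors: abc-iut cell, fact-proving seat abc-iut-f-074 (block F, tranche 74; FACT-LIST rows F-0326,
F-0330, F-0331, F-0333 of abc-iut-L4-t9's `BiAnabelianTelecore.lean`, exact criterion).
-/
import Literature.AnabelianGeometry.AbsoluteAnabelian.AbsTopIII.BiAnabelianStarLaxCells
import Literature.AnabelianGeometry.AbsoluteAnabelian.AbsTopIII.BiAnabelianTelecoreSchemaNegative

/-!
# [AbsTopIII] Cor 3.7 (ii)–(iv): the homotopies of the lax family on `𝒟*` at the pinned pairs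

S. Mochizuki, *Topics in absolute anabelian geometry III* [MochizukiAbsTopIII2015] (kurims manuscript
`paper:url-5493eb38cbb7`), Cor 3.7 (ii) p. 88 (`θ_{□⋎}`, `θ_⋎`), (iii) p. 88 (`ι_×`, `ι_{log,⋎}`), (iv) p. 88
(the telecore homotopy of the proof, cf. Cor 3.6 (iv) p. 82).

PROOF-ONLY companion of `BiAnabelianTelecore.lean` (abc-iut-L4-t9).  The lax family `starLaxFamily θ`
on `𝒟*` (`BiAnabelianStarLaxCells.lean`) is evaluated at the five kinds of pinned pairs of Cor 3.7
(ii)–(iv), by the uniqueness principle `laxFamily_η_eq` (as abc-iut-L4-t12 did for `ℋ_δ`):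

* `starLaxFamily_deltaPinned` — it contains the generators `θ_{□⋎}` (identity; `θ^bi` is trivial on the
  diagonal) and `θ_⋎ = θ_𝒳` of `ℋ_δ`: `DeltaPinned θ`, for EVERY setting and lift datum;
* `starLaxFamily_telePinned` — it contains the telecore homotopy `[δ_⋎] ⇝ [δ_⋎]∘[π_⋎]∘[log_𝒳]∘[δ_{⋎+1}]`
  (identity): `TelePinned`, for EVERY setting and lift datum;
* `starLaxFamily_η_starTimes` — its homotopy at `([λ^×],[λ^{×pf}])` IS `ι_×`, for every setting;
* `starLaxFamily_η_starLog` — its homotopy at `([λ^×]∘[pr_⋎]∘[log_𝒳], [λ^{×pf}]∘[pr_{⋎+1}])` is, at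
  `(A₁, A₂, α)`, the composite `λ^×(ℓ_{A₁}) ≫ ι_{×,A₁}` with `ℓ = logIsoId : log ≅ 𝟭` — because `θ^bi`
  at `log_𝒳(A₁, A₂, α) = (log A₁, A₂, gal(ℓ_{A₁}) ≫ α)` is `ℓ_{A₁} ≫ θ^bi_{(A₁,A₂,α)}` by the functoriality
  of the lift datum (`θbi_hom_app_logSq`); hence `StarLogPinned` holds for this family IFF
  `λ^×(ℓ_A) ≫ ι_{×,A} = ι_{log,A}` for all `A` (`starLaxFamily_starLogPinned`), the defect measured by the
  exact criterion of `BiAnabelianTelecoreIncompatibilityIff.lean`.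

Refereed pre-IUT anabelian geometry over abstract data; nothing here bears on [IUTchIII] Cor. 3.12; no
side taken; typed ≠ proved except for the theorems of this file.
-/

set_option autoImplicit false

namespace Literature.AnabelianGeometry.AbsoluteAnabelian

open CategoryTheory Quiver DiagramOfCategories

universe u

namespace AbsTopIII

/-! ## The lift datum at `log_𝒳` of an object -/

namespace BiAnabelianSetting

variable {X E N : Type u} [Category.{u} X] [Category.{u} E] [Category.{u} N]
  (𝔖 : BiAnabelianSetting X E N) (θ : FiberSquare.BiAnabelianLift 𝔖.gal)

/-- The morphism `(ℓ_{A₁}, id_{A₂}) : log_𝒳(A₁, A₂, α) = (log A₁, A₂, gal(ℓ_{A₁}) ≫ α) → (A₁, A₂, α)` of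
`𝒳 ×_𝔈 𝒳` (`ℓ = logIsoId : log ≅ 𝟭`). [cite: MochizukiAbsTopIII2015, Cor 3.7 p.86] -/
def logSqHom (o : 𝔖.Sq) : 𝔖.logSq.obj o ⟶ o where
  fst := 𝔖.logIsoId.hom.app o.fst
  snd := 𝟙 o.snd
  w := by
    simp [FiberSquare.overIso, BiAnabelianSetting.logGal]
    erw [Functor.map_id, Category.comp_id, Category.comp_id]
    rfl

/-- **`θ^bi` at `log_𝒳(A₁, A₂, α)` is `ℓ_{A₁} ≫ θ^bi_{(A₁,A₂,α)}`** (naturality of `θ^bi` along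
`(ℓ_{A₁}, id)`). [cite: MochizukiAbsTopIII2015, Cor 3.7 (ii) p.87] -/
theorem θbi_hom_app_logSq (o : 𝔖.Sq) :
    θ.θbi.hom.app (𝔖.logSq.obj o) = 𝔖.logIsoId.hom.app o.fst ≫ θ.θbi.hom.app o := by
  have h : 𝔖.logIsoId.hom.app o.fst ≫ θ.θbi.hom.app o = θ.θbi.hom.app (𝔖.logSq.obj o) ≫ 𝟙 o.snd :=
    θ.θbi.hom.naturality (𝔖.logSqHom o)
  rw [h]
  exact (Category.comp_id _).symm

/-- **`θ^bi` at `log_𝒳(δ_𝒳 A)` is `ℓ_A : log A ⥲ A`** (`θ^bi` is trivial on the diagonal).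
[cite: MochizukiAbsTopIII2015, Cor 3.7 (ii) p.87] -/
theorem θbi_hom_app_logSq_diag (A : X) :
    θ.θbi.hom.app (𝔖.logSq.obj (𝔖.diag.obj A)) = 𝔖.logIsoId.hom.app A := by
  rw [𝔖.θbi_hom_app_logSq θ, θ.θbi_app_diagonal]
  exact Category.comp_id _

/-- `(θ^bi)⁻¹` at `log_𝒳(δ_𝒳 A)` is `ℓ_A⁻¹ : A ⥲ log A`. [cite: MochizukiAbsTopIII2015, Cor 3.7 (ii) p.87] -/
theorem θbi_inv_app_logSq_diag (A : X) :
    θ.θbi.inv.app (𝔖.logSq.obj (𝔖.diag.obj A)) = 𝔖.logIsoId.inv.app A := by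
  rw [← cancel_epi (θ.θbi.hom.app (𝔖.logSq.obj (𝔖.diag.obj A))), Iso.hom_inv_id_app,
    𝔖.θbi_hom_app_logSq_diag θ]
  exact (𝔖.logIsoId.hom_inv_id_app A).symm

/-! ## Edge 2-cells of the shadow of `𝒟*` at objects -/

section CanE

/-- `can_{δ_⋎} = id`. [cite: MochizukiAbsTopIII2015, Cor 3.7 (ii) p.87] -/
theorem canE_diag (n : ℤ) (z : X) : (𝔖.deltaShadow θ).canE (Cor37Edge.diag.{u} n) z = 𝟙 z := rfl
/-- `can_{δ_⋎}⁻¹ = id`. [cite: MochizukiAbsTopIII2015, Cor 3.7 (ii) p.87] -/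
theorem canEI_diag (n : ℤ) (z : X) : (𝔖.deltaShadow θ).canEI (Cor37Edge.diag.{u} n) z = 𝟙 z := rfl
/-- `can_{δ_□} = id`. [cite: MochizukiAbsTopIII2015, Cor 3.7 (ii) p.87] -/
theorem canE_diagBox (z : X) : (𝔖.deltaShadow θ).canE Cor37Edge.diagBox.{u} z = 𝟙 z := rfl
/-- `can_{log_𝒳} = id`. [cite: MochizukiAbsTopIII2015, Cor 3.7 (ii) p.87] -/
theorem canE_log (m n : ℤ) (h : m = n + 1) (o : 𝔖.Sq) :
    (𝔖.deltaShadow θ).canE (Cor37Edge.log.{u} m n h) o = 𝟙 o.snd := rfl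
/-- `can_{log_𝒳}⁻¹ = id`. [cite: MochizukiAbsTopIII2015, Cor 3.7 (ii) p.87] -/
theorem canEI_log (m n : ℤ) (h : m = n + 1) (o : 𝔖.Sq) :
    (𝔖.deltaShadow θ).canEI (Cor37Edge.log.{u} m n h) o = 𝟙 o.snd := rfl
/-- `can_{π_⋎} = id`. [cite: MochizukiAbsTopIII2015, Cor 3.7 (ii) p.87] -/
theorem canE_proj (n : ℤ) (o : 𝔖.Sq) : (𝔖.deltaShadow θ).canE (Cor37Edge.proj.{u} n) o = 𝟙 o.snd := rfl
/-- `can_{π_⋎}⁻¹ = id`. [cite: MochizukiAbsTopIII2015, Cor 3.7 (ii) p.87] -/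
theorem canEI_proj (n : ℤ) (o : 𝔖.Sq) : (𝔖.deltaShadow θ).canEI (Cor37Edge.proj.{u} n) o = 𝟙 o.snd := rfl
/-- `can_{pr_⋎} = θ^bi`. [cite: MochizukiAbsTopIII2015, Cor 3.7 (ii) p.87] -/
theorem canE_pr (n : ℤ) (o : 𝔖.Sq) :
    (𝔖.deltaShadow θ).canE (Cor37Edge.pr.{u} n) o = θ.θbi.hom.app o := rfl
/-- `can_{pr_⋎}⁻¹ = (θ^bi)⁻¹`. [cite: MochizukiAbsTopIII2015, Cor 3.7 (ii) p.87] -/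
theorem canEI_pr (n : ℤ) (o : 𝔖.Sq) :
    (𝔖.deltaShadow θ).canEI (Cor37Edge.pr.{u} n) o = θ.θbi.inv.app o := rfl
/-- `can_{λ^×} = id`. [cite: MochizukiAbsTopIII2015, Cor 3.7 (iii) p.88] -/
theorem canE_lamTimes (z : X) : (𝔖.deltaShadow θ).canE Cor37Edge.lamTimes.{u} z = 𝟙 (𝔖.lamTimes.obj z) := rfl
/-- `can_{λ^{×pf}}⁻¹ = id`. [cite: MochizukiAbsTopIII2015, Cor 3.7 (iii) p.88] -/
theorem canEI_lamTimesPf (z : X) :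
    (𝔖.deltaShadow θ).canEI Cor37Edge.lamTimesPf.{u} z = 𝟙 (𝔖.lamTimesPf.obj z) := rfl
/-- `can_[nil]⁻¹ = id`. [cite: MochizukiAbsTopIII2015, Definition 3.5 (ii) p.75] -/
theorem canI_nil' (a : Cor37Vertex) (x : 𝔖.starDiagram.obj a) :
    (𝔖.deltaShadow θ).canI (Path.nil : StarPath.{u} a a) x = 𝟙 _ := rfl

end CanE

/-! ## The pinned generators of `ℋ_δ` and the telecore homotopy -/

/-- Identities at propositionally equal objects agree heterogeneously. [folklore] -/
private theorem id_heq_id' {C : Type u} [Category.{u} C] {A B : C} (h : A = B) : 𝟙 A ≍ 𝟙 B := by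
  subst h; rfl

/-- A functor applied to an `eqToHom`-conjugate is heterogeneously the functor applied to the middle.
[folklore] -/
private theorem map_conj_eqToHom_heq' {C D : Type u} [Category.{u} C] [Category.{u} D] (F : C ⥤ D)
    {A B B' A' : C} (a : A = B) (f : B ⟶ B') (b : B' = A') :
    F.map (eqToHom a ≫ f ≫ eqToHom b) ≍ F.map f := by
  subst a b; simp

/-- Components of an `eqToHom`-conjugated natural transformation. [folklore] -/
private theorem app_conj_eqToHom_heq {C D : Type u} [Category.{u} C] [Category.{u} D]
    {F F' G' G : C ⥤ D} (a : F = F') (τ : F' ⟶ G') (b : G' = G) (y : C) :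
    (eqToHom a ≫ τ ≫ eqToHom b).app y ≍ τ.app y := by
  subst a b; simp

/-- A functor applied to an `eqToHom` is heterogeneously an identity. [folklore] -/
private theorem map_eqToHom_heq_id {C D : Type u} [Category.{u} C] [Category.{u} D] (F : C ⥤ D)
    {A B : C} (a : A = B) : F.map (eqToHom a) ≍ 𝟙 (F.obj A) := by
  subst a; simp

/-- The pair `([δ_□], [pr_⋎]∘[δ_⋎])` lies in the boundary set of the lax family.
[cite: MochizukiAbsTopIII2015, Cor 3.7 (ii) p.88] -/
theorem starLaxFamily_mem_box (n : ℤ) : (𝔖.starLaxFamily θ).E deltaBoxPath.{u} (prDeltaPath.{u} n) :=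
  StarCellRel.ofEq rfl

/-- `θ_{□⋎}` in the lax family is the identity (because `θ^bi` is trivial on the diagonal `δ_𝒳`).
[cite: MochizukiAbsTopIII2015, Cor 3.7 (ii) p.88] -/
theorem starLaxFamily_η_box (n : ℤ) (x : X)
    (e : (𝔖.starDiagram.pathFunctor deltaBoxPath.{u}).obj x =
      (𝔖.starDiagram.pathFunctor (prDeltaPath.{u} n)).obj x) :
    ((𝔖.starLaxFamily θ).η (𝔖.starLaxFamily_mem_box θ n)).app x = eqToHom e := by
  have E : 𝔖.starDiagram.pathFunctor deltaBoxPath.{u} =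
      𝔖.starDiagram.pathFunctor (prDeltaPath.{u} n) := by
    rw [pathFunctor_eq_pathFunctor', pathFunctor_eq_pathFunctor']; rfl
  have hφ := (𝔖.deltaShadow θ).laxFamily_η_eq (𝔖.starLaxCells θ) (fun b _ => 𝔖.deltaFF θ b)
    (𝔖.starLaxFamily_mem_box θ n) (eqToHom E) fun y => by
      show (eqToHom E).app y ≍ _ ≫ (𝔖.starσ θ (𝔖.starLaxFamily_mem_box θ n)).app _ ≫ _
      rw [eqToHom_app, 𝔖.starσ_of_eq θ (𝔖.starLaxFamily_mem_box θ n) rfl, eqToHom_app]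
      exact ((eqToHom_heq_id_dom _ _ _).trans
        (id_heq_id' (by rw [pathFunctor_eq_pathFunctor']; rfl))).trans
        (heq_of_eq (𝔖.deltaShadow_box_aux θ n y).symm)
  change _ = (𝔖.starLaxFamily θ).η _ at hφ
  rw [← hφ, eqToHom_app]

/-- The pair `([γ¹_⋎], [γ⁰_⋎])` lies in the boundary set of the lax family.
[cite: MochizukiAbsTopIII2015, Cor 3.7 (ii) p.88] -/
theorem starLaxFamily_mem_theta (n : ℤ) :
    (𝔖.starLaxFamily θ).E (gammaOne.{u} n) (Path.nil : StarPath.{u} (.first n) (.first n)) :=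
  StarCellRel.ofEq rfl

/-- `θ_⋎` in the lax family is `θ_𝒳` (both lie over the identity of the second factor).
[cite: MochizukiAbsTopIII2015, Cor 3.7 (ii) p.88] -/
theorem starLaxFamily_η_theta (n : ℤ) (o : 𝔖.Sq)
    (e₁ : (𝔖.starDiagram.pathFunctor (gammaOne.{u} n)).obj o = (𝔖.proj ⋙ 𝔖.diag).obj o)
    (e₂ : (𝔖.starDiagram.pathFunctor (Path.nil : Path (Cor37Vertex.first n) _)).obj o = o) :
    ((𝔖.starLaxFamily θ).η (𝔖.starLaxFamily_mem_theta θ n)).app o =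
      eqToHom e₁ ≫ θ.thetaX.hom.app o ≫ eqToHom e₂.symm := by
  have E₁ : 𝔖.starDiagram.pathFunctor (gammaOne.{u} n) = 𝔖.proj ⋙ 𝔖.diag := by
    rw [pathFunctor_eq_pathFunctor']; rfl
  have E₂ : 𝟭 𝔖.Sq = 𝔖.starDiagram.pathFunctor (Path.nil : Path (Cor37Vertex.first n) _) := by
    rw [pathFunctor_nil]; rfl
  have hφ := (𝔖.deltaShadow θ).laxFamily_η_eq (𝔖.starLaxCells θ) (fun b _ => 𝔖.deltaFF θ b)
    (𝔖.starLaxFamily_mem_theta θ n) (eqToHom E₁ ≫ θ.thetaX.hom ≫ eqToHom E₂) fun y => by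
      show 𝔖.proj.map ((eqToHom E₁ ≫ θ.thetaX.hom ≫ eqToHom E₂).app y) ≍
        _ ≫ (𝔖.starσ θ (𝔖.starLaxFamily_mem_theta θ n)).app _ ≫ _
      rw [NatTrans.comp_app, NatTrans.comp_app, eqToHom_app, eqToHom_app,
        𝔖.starσ_of_eq θ (𝔖.starLaxFamily_mem_theta θ n) rfl, eqToHom_app]
      refine (map_conj_eqToHom_heq' 𝔖.proj _ (θ.thetaX.hom.app y) _).trans ?_
      exact heq_of_eq (show (𝟙 y.snd : y.snd ⟶ y.snd) =
        (𝟙 _ ≫ (𝟙 _ ≫ 𝟙 _)) ≫ eqToHom rfl ≫ 𝟙 _ by simp)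
  change _ = (𝔖.starLaxFamily θ).η _ at hφ
  rw [← hφ, NatTrans.comp_app, NatTrans.comp_app, eqToHom_app, eqToHom_app]

/-- **The lax family contains the generators of `ℋ_δ`** (`DeltaPinned θ`), for every setting and lift
datum. [cite: MochizukiAbsTopIII2015, Cor 3.7 (ii) p.88] -/
theorem starLaxFamily_deltaPinned : 𝔖.DeltaPinned θ (𝔖.starLaxFamily θ) :=
  ⟨fun n => ⟨𝔖.starLaxFamily_mem_box θ n, fun x e => 𝔖.starLaxFamily_η_box θ n x e⟩,
    fun n => ⟨𝔖.starLaxFamily_mem_theta θ n, fun o e₁ e₂ => 𝔖.starLaxFamily_η_theta θ n o e₁ e₂⟩⟩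

/-- The telecore pair `([δ_⋎], [δ_⋎]∘[π_⋎]∘[log_𝒳]∘[δ_{⋎+1}])` lies in the boundary set of the lax family.
[cite: MochizukiAbsTopIII2015, Cor 3.7 (iv) p.88] -/
theorem starLaxFamily_mem_tele (n : ℤ) : (𝔖.starLaxFamily θ).E (deltaPath.{u} n) (telePath.{u} n) :=
  StarCellRel.ofEq rfl

/-- The computation behind the telecore homotopy: all edge 2-cells along `[δ_⋎]` and
`[δ_⋎]∘[π_⋎]∘[log_𝒳]∘[δ_{⋎+1}]` are identities. [cite: MochizukiAbsTopIII2015, Cor 3.7 (iv) p.88] -/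
theorem deltaShadow_tele_aux (n : ℤ) (x : X) :
    (𝔖.deltaShadow θ).canH (deltaPath.{u} n) x ≫ eqToHom rfl ≫
      (𝔖.deltaShadow θ).canI (telePath.{u} n) x = 𝟙 x := by
  show (𝟙 x ≫ 𝟙 x) ≫ eqToHom rfl ≫ ((((𝟙 x ≫ 𝟙 x) ≫ 𝟙 x) ≫ 𝟙 x) ≫ 𝟙 x) = 𝟙 x
  simp

/-- The telecore homotopy in the lax family is the identity.
[cite: MochizukiAbsTopIII2015, Cor 3.7 (iv) p.88] -/
theorem starLaxFamily_η_tele (n : ℤ) (x : X)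
    (e : (𝔖.starDiagram.pathFunctor (deltaPath.{u} n)).obj x =
      (𝔖.starDiagram.pathFunctor (telePath.{u} n)).obj x) :
    ((𝔖.starLaxFamily θ).η (𝔖.starLaxFamily_mem_tele θ n)).app x = eqToHom e := by
  have E : 𝔖.starDiagram.pathFunctor (deltaPath.{u} n) = 𝔖.starDiagram.pathFunctor (telePath.{u} n) :=
    (𝔖.pathFunctor_telePath n).symm
  have hφ := (𝔖.deltaShadow θ).laxFamily_η_eq (𝔖.starLaxCells θ) (fun b _ => 𝔖.deltaFF θ b)
    (𝔖.starLaxFamily_mem_tele θ n) (eqToHom E) fun y => by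
      show 𝔖.proj.map ((eqToHom E).app y) ≍ _ ≫ (𝔖.starσ θ (𝔖.starLaxFamily_mem_tele θ n)).app _ ≫ _
      rw [eqToHom_app, 𝔖.starσ_of_eq θ (𝔖.starLaxFamily_mem_tele θ n) rfl, eqToHom_app]
      exact ((map_eqToHom_heq_id 𝔖.proj _).trans
        (id_heq_id' (by rw [pathFunctor_eq_pathFunctor']; rfl))).trans
        (heq_of_eq (𝔖.deltaShadow_tele_aux θ n y).symm)
  change _ = (𝔖.starLaxFamily θ).η _ at hφ
  rw [← hφ, eqToHom_app]

/-- **The lax family contains the telecore homotopy** (`TelePinned`), for every setting and lift datum.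
[cite: MochizukiAbsTopIII2015, Cor 3.7 (iv) p.88] -/
theorem starLaxFamily_telePinned : 𝔖.TelePinned (𝔖.starLaxFamily θ) :=
  fun n => ⟨𝔖.starLaxFamily_mem_tele θ n, fun x e => 𝔖.starLaxFamily_η_tele θ n x e⟩

/-! ## The `𝔖†_log`-pairs -/

/-- The pair `([λ^×],[λ^{×pf}])` lies in the boundary set of the lax family.
[cite: MochizukiAbsTopIII2015, Cor 3.7 (iii) p.88] -/
theorem starLaxFamily_mem_times : (𝔖.starLaxFamily θ).E (starTimes.{u} true) (starTimes.{u} false) :=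
  StarCellRel.iota rfl rfl

/-- The λ-types of `[λ^×]` and `[λ^{×pf}]` differ. [cite: MochizukiAbsTopIII2015, Cor 3.7 (iii) p.88] -/
theorem starLamType_starTimes_ne : starLamType (starTimes.{u} true) ≠ starLamType (starTimes.{u} false) := by
  decide

/-- The computation behind the `ι_×`-pair: the lax family's homotopy at `([λ^×],[λ^{×pf}])` is `ι_×`.
[cite: MochizukiAbsTopIII2015, Cor 3.7 (iii) p.88] -/
theorem deltaShadow_times_aux (y : X) :
    (𝔖.deltaShadow θ).canH (starTimes.{u} true) y ≫
      (𝔖.starσ θ (𝔖.starLaxFamily_mem_times θ)).app (((𝔖.deltaShadow θ).aug Cor37Vertex.box).obj y) ≫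
      (𝔖.deltaShadow θ).canI (starTimes.{u} false) y = 𝔖.iotaTimes.app y := by
  rw [𝔖.starσ_of_ne θ _ starLamType_starTimes_ne, NatTrans.comp_app, eqToHom_app]
  show (𝟙 (𝔖.lamTimes.obj y) ≫ 𝔖.lamTimes.map (𝟙 y)) ≫
    ((𝔖.lamTimes.map (𝟙 y) ≫ 𝔖.iotaTimes.app y) ≫ eqToHom rfl) ≫
    (𝔖.lamTimesPf.map (𝟙 y) ≫ 𝟙 (𝔖.lamTimesPf.obj y)) = _
  simp

/-- **The homotopy of the lax family at `([λ^×],[λ^{×pf}])` is `ι_×`.**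
[cite: MochizukiAbsTopIII2015, Cor 3.7 (iii) p.88] -/
theorem starLaxFamily_η_times (x : X)
    (e₁ : (𝔖.starDiagram.pathFunctor (starTimes.{u} true)).obj x = 𝔖.lamTimes.obj x)
    (e₂ : (𝔖.starDiagram.pathFunctor (starTimes.{u} false)).obj x = 𝔖.lamTimesPf.obj x) :
    ((𝔖.starLaxFamily θ).η (𝔖.starLaxFamily_mem_times θ)).app x =
      eqToHom e₁ ≫ 𝔖.iotaTimes.app x ≫ eqToHom e₂.symm := by
  have E₁ : 𝔖.starDiagram.pathFunctor (starTimes.{u} true) = 𝔖.lamTimes := by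
    rw [pathFunctor_eq_pathFunctor']; rfl
  have E₂ : 𝔖.lamTimesPf = 𝔖.starDiagram.pathFunctor (starTimes.{u} false) := by
    rw [pathFunctor_eq_pathFunctor']; rfl
  have hφ := (𝔖.deltaShadow θ).laxFamily_η_eq (𝔖.starLaxCells θ) (fun b _ => 𝔖.deltaFF θ b)
    (𝔖.starLaxFamily_mem_times θ) (eqToHom E₁ ≫ 𝔖.iotaTimes ≫ eqToHom E₂) fun y =>
      (app_conj_eqToHom_heq E₁ 𝔖.iotaTimes E₂ y).trans (heq_of_eq (𝔖.deltaShadow_times_aux θ y).symm)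
  change _ = (𝔖.starLaxFamily θ).η _ at hφ
  rw [← hφ, NatTrans.comp_app, NatTrans.comp_app, eqToHom_app, eqToHom_app]

/-- The pair `([λ^×]∘[pr_⋎]∘[log_𝒳], [λ^{×pf}]∘[pr_{⋎+1}])` lies in the boundary set of the lax family.
[cite: MochizukiAbsTopIII2015, Cor 3.7 (iii) p.88] -/
theorem starLaxFamily_mem_log (n : ℤ) : (𝔖.starLaxFamily θ).E (starLogLeft.{u} n) (starLogRight.{u} n) :=
  StarCellRel.iota rfl rfl

/-- The λ-types of `[λ^×]∘[pr_⋎]∘[log_𝒳]` and `[λ^{×pf}]∘[pr_{⋎+1}]` differ.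
[cite: MochizukiAbsTopIII2015, Cor 3.7 (iii) p.88] -/
theorem starLamType_starLog_ne (n : ℤ) :
    starLamType (starLogLeft.{u} n) ≠ starLamType (starLogRight.{u} n) := by
  simp [starLogLeft, starLogRight, starLamType, Cor37Edge.lamType]

/-- The computation behind the `ι_{log,⋎}`-pair: the lax family's homotopy at
`([λ^×]∘[pr_⋎]∘[log_𝒳], [λ^{×pf}]∘[pr_{⋎+1}])`, at `(A₁, A₂, α)`, is `λ^×(θ^bi_{log_𝒳 o}) ≫ ι_{×,A₂} ≫
λ^{×pf}((θ^bi_o)⁻¹) = λ^×(ℓ_{A₁}) ≫ ι_{×,A₁}`. [cite: MochizukiAbsTopIII2015, Cor 3.7 (iii) p.88] -/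
theorem deltaShadow_log_aux (n : ℤ) (o : 𝔖.Sq) :
    (𝔖.deltaShadow θ).canH (starLogLeft.{u} n) o ≫
      (𝔖.starσ θ (𝔖.starLaxFamily_mem_log θ n)).app
        (((𝔖.deltaShadow θ).aug (Cor37Vertex.first (n + 1))).obj o) ≫
      (𝔖.deltaShadow θ).canI (starLogRight.{u} n) o =
      𝔖.lamTimes.map (𝔖.logIsoId.hom.app o.fst) ≫ 𝔖.iotaTimes.app o.fst := by
  rw [𝔖.starσ_of_ne θ _ (starLamType_starLog_ne n), NatTrans.comp_app, eqToHom_app]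
  show (𝟙 _ ≫ 𝔖.lamTimes.map (θ.θbi.hom.app (𝔖.logSq.obj o) ≫ (𝟙 _ ≫ 𝟙 _))) ≫
    ((𝔖.lamTimes.map ((𝟙 _ ≫ 𝟙 _) ≫ 𝟙 _) ≫ 𝔖.iotaTimes.app o.snd) ≫ eqToHom rfl) ≫
    (𝔖.lamTimesPf.map (𝟙 _ ≫ θ.θbi.inv.app o) ≫ 𝟙 _) = _
  simp only [Functor.map_id, Category.id_comp, Category.comp_id, eqToHom_refl]
  erw [← 𝔖.iotaTimes.naturality (θ.θbi.inv.app o), ← Category.assoc, ← Functor.map_comp,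
    𝔖.θbi_hom_app_logSq θ, Category.assoc, Iso.hom_inv_id_app, Category.comp_id]
  rfl

/-- **The homotopy of the lax family at `([λ^×]∘[pr_⋎]∘[log_𝒳], [λ^{×pf}]∘[pr_{⋎+1}])`** is, at
`(A₁, A₂, α)`, the composite `λ^×(ℓ_{A₁}) ≫ ι_{×,A₁}` (`ℓ = logIsoId`).
[cite: MochizukiAbsTopIII2015, Cor 3.7 (iii) p.88] -/
theorem starLaxFamily_η_log (n : ℤ) (o : 𝔖.Sq)
    (e₁ : (𝔖.starDiagram.pathFunctor (starLogLeft.{u} n)).obj o = 𝔖.lamTimes.obj (𝔖.log.obj o.fst))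
    (e₂ : (𝔖.starDiagram.pathFunctor (starLogRight.{u} n)).obj o = 𝔖.lamTimesPf.obj o.fst) :
    ((𝔖.starLaxFamily θ).η (𝔖.starLaxFamily_mem_log θ n)).app o =
      eqToHom e₁ ≫ (𝔖.lamTimes.map (𝔖.logIsoId.hom.app o.fst) ≫ 𝔖.iotaTimes.app o.fst) ≫
        eqToHom e₂.symm := by
  have E₁ : 𝔖.starDiagram.pathFunctor (starLogLeft.{u} n) = 𝔖.logSq ⋙ 𝔖.pr ⋙ 𝔖.lamTimes := by
    rw [pathFunctor_eq_pathFunctor']; rfl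
  have E₂ : 𝔖.pr ⋙ 𝔖.lamTimesPf = 𝔖.starDiagram.pathFunctor (starLogRight.{u} n) := by
    rw [pathFunctor_eq_pathFunctor']; rfl
  -- the natural transformation `λ^×(ℓ ▹ pr) ≫ (ι_× ▹ pr)`
  let τ : 𝔖.logSq ⋙ 𝔖.pr ⋙ 𝔖.lamTimes ⟶ 𝔖.pr ⋙ 𝔖.lamTimesPf :=
    Functor.whiskerRight (Functor.whiskerLeft 𝔖.pr 𝔖.logIsoId.hom) 𝔖.lamTimes ≫ 𝔖.iotaTimesAt
  have hτ : ∀ o : 𝔖.Sq,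
      τ.app o = 𝔖.lamTimes.map (𝔖.logIsoId.hom.app o.fst) ≫ 𝔖.iotaTimes.app o.fst := fun o => rfl
  have hφ := (𝔖.deltaShadow θ).laxFamily_η_eq (𝔖.starLaxCells θ) (fun b _ => 𝔖.deltaFF θ b)
    (𝔖.starLaxFamily_mem_log θ n) (eqToHom E₁ ≫ τ ≫ eqToHom E₂) fun y =>
      (app_conj_eqToHom_heq E₁ τ E₂ y).trans
        (heq_of_eq ((hτ y).trans (𝔖.deltaShadow_log_aux θ n y).symm))
  change _ = (𝔖.starLaxFamily θ).η _ at hφ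
  rw [← hφ, NatTrans.comp_app, NatTrans.comp_app, eqToHom_app, eqToHom_app, hτ]
  rfl

/-- **The lax family contains the `𝔖†_log` homotopies `ι_×`, `ι_{log,⋎}` (`StarLogPinned`) as soon as
`λ^×(ℓ_A) ≫ ι_{×,A} = ι_{log,A}` for every object `A` of `𝒳`** (`ℓ = logIsoId : log ≅ 𝟭`).
[cite: MochizukiAbsTopIII2015, Cor 3.7 (iv) p.88] -/
theorem starLaxFamily_starLogPinned
    (hC : ∀ A : X, 𝔖.lamTimes.map (𝔖.logIsoId.hom.app A) ≫ 𝔖.iotaTimes.app A = 𝔖.iotaLog.app A) :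
    𝔖.StarLogPinned (𝔖.starLaxFamily θ) :=
  ⟨⟨𝔖.starLaxFamily_mem_times θ, fun x e₁ e₂ => 𝔖.starLaxFamily_η_times θ x e₁ e₂⟩,
    fun n => ⟨𝔖.starLaxFamily_mem_log θ n, fun o e₁ e₂ => by
      rw [𝔖.starLaxFamily_η_log θ n o e₁ e₂]
      erw [hC o.fst]⟩⟩

end BiAnabelianSetting

end AbsTopIII

end Literature.AnabelianGeometry.AbsoluteAnabelian
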